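import Mathlib.Topology.Algebra.Category.ProfiniteGrp.Basic
import Mathlib.GroupTheory.Index
import Mathlib.GroupTheory.Torsion
import Literature.AnabelianGeometry.AbsoluteAnabelian.FundamentalExtension
import Literature.AnabelianGeometry.Anabelioids.ProSigma
import HarnessLib

/-!
# [AbsTopII] §3: elliptically admissible orbicurves (Def 3.1), strictly Belyi type (Def 3.5)

S. Mochizuki, *Topics in Absolute Anabelian Geometry II: Decomposition Groups and Endomorphisms*
[AbsTopII], §3 "Elliptic and Belyi Cuspidalizations": the setting of §3 (p. 65), Definition 3.1
(p. 65), Remark 3.1.1 (p. 65), Definition 3.5 (p. 71), the semi-elliptic double coverings of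
Corollary 3.3 (ii) (p. 68); §0 "Curves" (p. 6): *semi-elliptic*, *isogenous*.  Page locators `p.N`
are the PDF pages of the author's manuscript (lit key `paper:url-585b8d0ad0d9`, 76 pp.); the
journal pagination is not held.  Bib key `MochizukiAbsTopII2013`.  Census nodes typed here:
AbsTopII:Sec3, Def3.1, Def3.5, Cor3.3(ii); Ex 3.2 / Cor 3.3 (i)(iii) / Rmk 3.3.x are in
`AbsTopII/EllipticCuspidalization.lean`, Cor 3.7 in the Belyi-cuspidalization sequel.

## Setting (§3 p. 65, node "Sec3")

"Let `X` be a hyperbolic orbicurve over a field `k` of characteristic zero; `k̄` an algebraic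
closure of `k`. [...] we have an exact sequence of fundamental groups
`1 → π₁(X_k̄) → π₁(X) → Gal(k̄/k) → 1`" — the tree's `FundamentalExtension` (abc-iut-L4-t1).
"Let `π₁(X) ↠ Π` be a quotient of profinite groups. Write `Δ ⊆ Π` for the image of `π₁(X_k̄)` in
`Π`" (Def 3.1) — `ArithmeticQuotient` below.

## How the items are typed (cell ruling θ: shape (M); no closed `∃` over a free "arises from")

The GEOMETRIC notions — `k`-core ([Mzk6] Rmk 2.1.1), semi-elliptic, isogenous (§0 p. 6),
once-punctured elliptic curve, hyperbolic curve of genus zero, "defined over a number field" —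
are typed over `IsogenyModel`, the ISOGENY-LEVEL model interface: hyperbolic orbicurves over
fields of characteristic zero, finite étale morphisms between them over varying base fields, each
curve with its extension `π₁(X) ↠ G_k` and each morphism with its induced OPEN INJECTIVE
homomorphism of extensions; the numerical type `(g, r)`; scheme-vs-orbicurve.  It has NO instance
in the tree (the étale-`π₁` instance is a FACT-row construction); a junk model falsifies only
statements about itself.
-- TODO-merge abc-iut-L4-t1: `AbsTopIII/CurveModel.lean` (`CurveModel`, p404531) is the cell's
model of curves over ONE base field with cofinite opens; on request the fields below are added
there and `IsogenyModel` is re-based on it.  `CurveModel.IsStrictlyBelyiType` is a primitive field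
there, `IsogenyModel.IsStrictlyBelyiType` below is the PRINTED Definition 3.5; the merged model is
to carry the axiom identifying the two.

Deliberately NOT here: the profinite topology on `Aut`/`Out` (§0 p. 5); Rmk 3.1.1 beyond its use in
`IsSemiElliptic` (recorded there); the general GSAFG-type / scheme-theoretic-envelope form of
Cor 3.3 (ii) ([AbsTopI] Def 2.1/4.6 — abc-iut-L4-t4 / -t13 names, TODO-import).
HONEST FRAMING: typed ≠ discharged; nothing here takes a side on [IUTchIII] Cor 3.12.
-/

open CategoryTheory Topology

universe u

namespace Literature.AnabelianGeometry.AbsoluteAnabelian.AbsTopII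

open Literature.AnabelianGeometry.Anabelioids (IsSigmaInteger)
open FundamentalExtension

/-! ### Pro-`Σ` groups and arithmetic quotients (Def 3.1, preamble) -/

/-- A topological group is *pro-`Σ`* when every open normal subgroup of finite index has index a
`Σ`-integer (all prime factors in `Σ`; the tree's `Anabelioids.IsSigmaInteger`); for a profinite
group this is the usual notion (open subgroups have finite index).  Used in Def 3.1 (c): "for
every set of primes `Σ` such that some open subgroup of `Δ` is pro-`Σ`, it holds that `Δ` is
pro-`Σ`". [cite: MochizukiAbsTopII2013, Def 3.1 (c) p.65] -/
@[mk_iff] structure IsProSigmaGroup (S : Set ℕ) (G : Type u) [Group G] [TopologicalSpace G] :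
    Prop where
  /-- open normal subgroups of finite index have `Σ`-integer index -/
  index_isSigmaInteger : ∀ N : Subgroup G, N.Normal → IsOpen (N : Set G) → N.FiniteIndex →
    IsSigmaInteger S N.index

/-- "Let `π₁(X) ↠ Π` be a quotient of profinite groups. Write `Δ ⊆ Π` for the image of `π₁(X_k̄)`
in `Π`" (Def 3.1 p. 65): a quotient of the extension `E` (= `π₁(X) ↠ G_k`) is an extension `ext`
(= `Π ↠ Π/Δ`) with a morphism `proj : E ⟶ ext` surjective on `Π` and such that `Δ_ext` is the
image of `Δ_E`. [cite: MochizukiAbsTopII2013, Def 3.1 p.65] -/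
structure ArithmeticQuotient (E : FundamentalExtension.{u}) : Type (u + 1) where
  /-- the quotient extension `Π ↠ Π/Δ` -/
  ext : FundamentalExtension.{u}
  /-- the quotient map `π₁(X) ↠ Π` (with the induced map on Galois groups) -/
  proj : E ⟶ ext
  /-- `π₁(X) ↠ Π` is surjective -/
  arith_surjective : Function.Surjective proj.arith
  /-- "`Δ ⊆ Π` [is] the image of `π₁(X_k̄)` in `Π`" -/
  map_geom_eq : E.geom.map proj.arith.toMonoidHom = ext.geom

/-- The trivial quotient `Π = π₁(X)` ("When `Π = π₁(X)`, we shall simply say that `X` is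
elliptically admissible", Def 3.1 p. 65). [cite: MochizukiAbsTopII2013, Def 3.1 p.65] -/
def ArithmeticQuotient.self (E : FundamentalExtension.{u}) : ArithmeticQuotient E where
  ext := E
  proj := 𝟙 E
  arith_surjective := fun x => ⟨x, rfl⟩
  map_geom_eq := by
    ext x
    simp only [Subgroup.mem_map, id_arith]
    constructor
    · rintro ⟨y, hy, rfl⟩
      exact hy
    · exact fun hx => ⟨x, hx, rfl⟩

/-! ### The isogeny-level model interface (§0 p. 6 "Curves"; shape (M)) -/

/-- MODEL INTERFACE (isogeny level; no instance in the tree).  `Curve` = hyperbolic orbicurves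
over fields of characteristic zero, each with its extension `ext X` = (`π₁(X) ↠ Gal(k̄/k)`, §3
p. 65); `FinEt Y X` = finite étale morphisms `Y → X` lying over a finite separable inclusion of
base fields `k_X ↪ k_Y` (§0 p. 6: "the morphisms `X → X_i` induce finite separable inclusions of
fields `k_i ↪ k`"), each inducing an OPEN INJECTIVE homomorphism of extensions (`Π_Y ↪ Π_X` open,
`G_{k_Y} ↪ G_{k_X}` open); `IsScheme X` = "`X` is a hyperbolic curve [i.e., as opposed to an
arbitrary hyperbolic orbicurve]" (Rmk 3.1.1 p. 65); `genus`, `cuspCard` = the type `(g, r)`;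
`IsDefinedOverNF X` = "`X` is defined over a number field" (Def 3.5 p. 71).
-- TODO-merge abc-iut-L4-t1 CurveModel (see the module docstring).
[cite: MochizukiAbsTopII2013, §0 p.6] -/
structure IsogenyModel : Type (u + 1) where
  /-- hyperbolic orbicurves over fields of characteristic zero -/
  Curve : Type u
  /-- `X ↦ (1 → π₁(X_k̄) → π₁(X) → Gal(k̄/k) → 1)` -/
  ext : Curve → FundamentalExtension.{u}
  /-- finite étale morphisms `Y → X` (over a finite extension of base fields) -/
  FinEt : Curve → Curve → Type u
  /-- the induced homomorphism of extensions -/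
  extMap : ∀ {Y X : Curve}, FinEt Y X → (ext Y ⟶ ext X)
  /-- it is open injective on `Π` and on `G` -/
  extMap_isOpenInjective : ∀ {Y X : Curve} (f : FinEt Y X), (extMap f).IsOpenInjective
  /-- "is a hyperbolic curve" (a scheme), as opposed to a properly stacky orbicurve -/
  IsScheme : Curve → Prop
  /-- the genus `g` of (the compactification of) a hyperbolic curve of type `(g, r)` -/
  genus : Curve → ℕ
  /-- the number `r` of cusps (over `k̄`) -/
  cuspCard : Curve → ℕ
  /-- "defined over a number field": `X ≅ X_F ×_F k` for a number field `F ⊆ k` -/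
  IsDefinedOverNF : Curve → Prop

namespace IsogenyModel

variable (M : IsogenyModel.{u})

/-- `f : Y → X` is a morphism OVER the base field of `X` (`k_Y = k_X`): the induced map
`G_{k_Y} → G_{k_X}` is bijective. [cite: MochizukiAbsTopII2013, §0 p.6] -/
def IsOver {Y X : M.Curve} (f : M.FinEt Y X) : Prop := Function.Bijective (M.extMap f).gal

/-- The open subgroup `Π_Y ⊆ Π_X` determined by a finite étale `f : Y → X`.
[cite: MochizukiAbsTopII2013, §0 p.6] -/
def arithImage {Y X : M.Curve} (f : M.FinEt Y X) : Subgroup (M.ext X).arith :=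
  (M.extMap f).arith.toMonoidHom.range

/-- The degree of a finite étale `f : Y → X` over `k_X`, read off as the index `[Π_X : Π_Y]` (for
a morphism over `k_X` this is the degree; `0` would encode an infinite index, which does not occur
for open subgroups of profinite groups). [cite: MochizukiAbsTopII2013, §0 p.6] -/
noncomputable def degree {Y X : M.Curve} (f : M.FinEt Y X) : ℕ := (M.arithImage f).index

/-- §0 p. 6: "`X₁`, `X₂` are *isogenous* if there exists a hyperbolic orbicurve `X` over a field
`k`, together with finite étale morphisms `X → X_i`, for `i = 1, 2`."
[cite: MochizukiAbsTopII2013, §0 p.6] -/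
def Isogenous (X₁ X₂ : M.Curve) : Prop :=
  ∃ X : M.Curve, Nonempty (M.FinEt X X₁) ∧ Nonempty (M.FinEt X X₂)

/-- `k`-isogenous: isogenous through morphisms over the common base field `k` (the objects of
`Loc_k(X)` of [Mzk6] §2; cf. [AbsTopI] Ex 4.8 p. 59 "`Loc(−)`").
[cite: MochizukiAbsTopII2013, Def 3.1 (a) p.65] -/
def KIsogenous (X₁ X₂ : M.Curve) : Prop :=
  ∃ (X : M.Curve) (f₁ : M.FinEt X X₁) (f₂ : M.FinEt X X₂), M.IsOver f₁ ∧ M.IsOver f₂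

/-- "`X` admits a `k`-core [in the sense of [Mzk6], Remark 2.1.1] `X → C`" (Def 3.1 (a) p. 65):
`C` is a *`k`-core of `X`* when there is a finite étale `k`-morphism `X → C` and `C` is TERMINAL
among the hyperbolic orbicurves `k`-isogenous to `X` with finite étale `k`-morphisms (for every
such `Y` there is exactly one `k`-morphism `Y → C`). [cite: MochizukiAbsTopII2013, Def 3.1 (a) p.65] -/
def IsCoreOf (C X : M.Curve) : Prop :=
  (∃ f : M.FinEt X C, M.IsOver f) ∧
    ∀ Y : M.Curve, M.KIsogenous Y X →
      (∃ g : M.FinEt Y C, M.IsOver g) ∧ ∀ g g' : M.FinEt Y C, M.IsOver g → M.IsOver g' → g = g'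

/-- A *once-punctured elliptic curve*: a hyperbolic CURVE of type `(1, 1)` (§0 p. 6).
[cite: MochizukiAbsTopII2013, §0 p.6] -/
def IsOncePuncturedElliptic (D : M.Curve) : Prop :=
  M.IsScheme D ∧ M.genus D = 1 ∧ M.cuspCard D = 1

/-- §0 p. 6: "a hyperbolic orbicurve `X` [is] *semi-elliptic* [i.e., of type `(1,1)±`] if there
exists a finite étale double covering `Y → X`, where `Y` is a once-punctured elliptic curve, and
the covering is given by the stack-theoretic quotient of `Y` by the action of `±1`".  Typed: `X`
is NOT a scheme and admits a degree-`2` covering over `k` by a once-punctured elliptic curve (the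
only involution of an elliptic curve fixing the origin being `−1`, such a quotient is the
`±1`-quotient; Rmk 3.1.1 p. 65: `D_k̄ → C_k̄` is "the unique finite étale double covering of `C_k̄`
by a hyperbolic curve").  -- TODO(general form): the clause "given by the quotient by `±1`" is
rendered by `¬ IsScheme X ∧ degree = 2`, not by an action. [cite: MochizukiAbsTopII2013, §0 p.6] -/
def IsSemiElliptic (X : M.Curve) : Prop :=
  ¬ M.IsScheme X ∧ ∃ (Y : M.Curve) (f : M.FinEt Y X), M.IsOver f ∧ M.IsOncePuncturedElliptic Y ∧
    M.degree f = 2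

/-- **Definition 3.5** p. 71: "`X` is *of strictly Belyi type* if it is defined over a number
field and isogenous to a hyperbolic curve of genus zero."  (The cell's `CurveModel` carries a
primitive field of the same name — TODO-merge abc-iut-L4-t1: the merged model identifies the two.)
[cite: MochizukiAbsTopII2013, Def 3.5 p.71] -/
def IsStrictlyBelyiType (X : M.Curve) : Prop :=
  M.IsDefinedOverNF X ∧ ∃ T : M.Curve, M.IsScheme T ∧ M.genus T = 0 ∧ M.Isogenous X T

/-- Isogeny is symmetric (immediate from the definition). [cite: MochizukiAbsTopII2013, §0 p.6] -/
theorem Isogenous.symm {M : IsogenyModel.{u}} {X₁ X₂ : M.Curve} (h : M.Isogenous X₁ X₂) :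
    M.Isogenous X₂ X₁ := by
  obtain ⟨X, h₁, h₂⟩ := h
  exact ⟨X, h₂, h₁⟩

/-- `k`-isogeny is symmetric. [cite: MochizukiAbsTopII2013, Def 3.1 (a) p.65] -/
theorem KIsogenous.symm {M : IsogenyModel.{u}} {X₁ X₂ : M.Curve} (h : M.KIsogenous X₁ X₂) :
    M.KIsogenous X₂ X₁ := by
  obtain ⟨X, f₁, f₂, h₁, h₂⟩ := h
  exact ⟨X, f₂, f₁, h₂, h₁⟩

/-- Of two `k`-cores of the same `X`, each admits exactly one `k`-morphism to the other
(terminality) — the formal content of speaking of "the" `k`-core.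
[cite: MochizukiAbsTopII2013, Def 3.1 (a) p.65] -/
theorem IsCoreOf.existsUnique_hom {M : IsogenyModel.{u}} {C C' X : M.Curve} (h : M.IsCoreOf C X)
    (h' : M.IsCoreOf C' X) (e : M.FinEt X X) (he : M.IsOver e) :
    (∃ g : M.FinEt C' C, M.IsOver g) ∧ ∀ g g' : M.FinEt C' C, M.IsOver g → M.IsOver g' → g = g' := by
  obtain ⟨⟨f', hf'⟩, -⟩ := h'
  exact h.2 C' ⟨X, f', e, hf', he⟩

end IsogenyModel

/-! ### Definition 3.1: `Π`-elliptically admissible -/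

/-- The DATA of **Definition 3.1** p. 65 for `X` and the quotient `π₁(X) ↠ Π` (`Q`): "(a) `X`
admits a `k`-core `X → C`; (b) `C` is semi-elliptic, hence admits a double covering `D → C` by a
once-punctured elliptic curve `D`; (c) `X` admits a finite étale covering `Y → X` by a hyperbolic
curve `Y` over a finite extension `k_Y` of `k` that arises from a normal open subgroup `Π_Y ⊆ Π`
such that the resulting finite étale covering `Y → C` factors as the composite of a covering
`Y → D` with the covering `D → C` and, moreover, is such that, for every set of primes `Σ` such
that some open subgroup of `Δ` is pro-`Σ`, it holds that `Δ` is pro-`Σ`, and, moreover, the degree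
of the covering `Y → C ×_k k_Y` is a product of primes [perhaps with multiplicities] `∈ Σ`."
The factorisation `Y → D → C` of `Y → X → C` is recorded on the induced homomorphisms of
extensions; the degree of `Y → C ×_k k_Y` is the index of `Π_Y` in `Π_C ×_{G_k} G_{k_Y}`.
[cite: MochizukiAbsTopII2013, Def 3.1 p.65] -/
structure EllipticAdmissibilityWitness (M : IsogenyModel.{u}) (X : M.Curve)
    (Q : ArithmeticQuotient (M.ext X)) : Type u where
  /-- (a) the `k`-core `C` -/
  core : M.Curve
  /-- (a) the `k`-morphism `X → C` -/
  toCore : M.FinEt X core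
  /-- (a) `X → C` is over `k` -/
  toCore_isOver : M.IsOver toCore
  /-- (a) `C` is a `k`-core of `X` -/
  isCoreOf : M.IsCoreOf core X
  /-- (b) `C` is semi-elliptic: a properly stacky orbicurve … -/
  core_not_isScheme : ¬ M.IsScheme core
  /-- (b) … doubly covered by the once-punctured elliptic curve `D` -/
  ell : M.Curve
  /-- (b) the double covering `D → C` -/
  ellToCore : M.FinEt ell core
  /-- (b) `D → C` is over `k` -/
  ellToCore_isOver : M.IsOver ellToCore
  /-- (b) `D` is a once-punctured elliptic curve -/
  ell_oncePunctured : M.IsOncePuncturedElliptic ell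
  /-- (b) `D → C` is a double covering -/
  degree_ellToCore : M.degree ellToCore = 2
  /-- (c) the covering curve `Y` -/
  cov : M.Curve
  /-- (c) `Y` is a hyperbolic curve (a scheme) -/
  cov_isScheme : M.IsScheme cov
  /-- (c) the finite étale covering `Y → X` -/
  covMap : M.FinEt cov X
  /-- (c) the covering `Y → D` -/
  covToEll : M.FinEt cov ell
  /-- (c) the normal open subgroup `Π_Y ⊆ Π` … -/
  PiY : Subgroup Q.ext.arith
  /-- (c) … is normal -/
  normal_PiY : PiY.Normal
  /-- (c) … is open -/
  isOpen_PiY : IsOpen (PiY : Set Q.ext.arith)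
  /-- (c) "`Y → X` arises from `Π_Y ⊆ Π`": `Π_Y ⊆ π₁(X)` is the preimage of `Π_Y ⊆ Π` -/
  arithImage_covMap : M.arithImage covMap = PiY.comap Q.proj.arith.toMonoidHom
  /-- (c) `Y → X → C` factors as `Y → D → C` -/
  fac : M.extMap covMap ≫ M.extMap toCore = M.extMap covToEll ≫ M.extMap ellToCore
  /-- (c) the pro-`Σ` clause on `Δ ⊆ Π` and the degree of `Y → C ×_k k_Y` -/
  proSigma : ∀ S : Set ℕ,
    (∃ H : Subgroup Q.ext.geom, IsOpen (H : Set Q.ext.geom) ∧ IsProSigmaGroup S H) →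
      IsProSigmaGroup S Q.ext.geom ∧
        IsSigmaInteger S
          (((M.extMap covMap ≫ M.extMap toCore).arith.toMonoidHom.range).relIndex
            (((M.extMap covMap ≫ M.extMap toCore).gal.toMonoidHom.range).comap
              (M.ext core).aug.toMonoidHom))

/-- **Definition 3.1** p. 65: "`X` is `Π`-elliptically admissible" for the quotient
`π₁(X) ↠ Π` recorded by `Q`. [cite: MochizukiAbsTopII2013, Def 3.1 p.65] -/
def IsEllipticallyAdmissibleWith (M : IsogenyModel.{u}) (X : M.Curve)
    (Q : ArithmeticQuotient (M.ext X)) : Prop :=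
  Nonempty (EllipticAdmissibilityWitness M X Q)

/-- **Definition 3.1** p. 65, last sentence: "When `Π = π₁(X)`, we shall simply say that `X` is
*elliptically admissible*." [cite: MochizukiAbsTopII2013, Def 3.1 p.65] -/
def IsEllipticallyAdmissible (M : IsogenyModel.{u}) (X : M.Curve) : Prop :=
  IsEllipticallyAdmissibleWith M X (ArithmeticQuotient.self (M.ext X))

/-- Condition (b) of Def 3.1 as typed implies "`C` is semi-elliptic" as typed (cross-check of the
two renderings). [cite: MochizukiAbsTopII2013, Def 3.1 (b) p.65] -/
theorem EllipticAdmissibilityWitness.isSemiElliptic_core {M : IsogenyModel.{u}} {X : M.Curve}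
    {Q : ArithmeticQuotient (M.ext X)} (W : EllipticAdmissibilityWitness M X Q) :
    M.IsSemiElliptic W.core :=
  ⟨W.core_not_isScheme, W.ell, W.ellToCore, W.ellToCore_isOver, W.ell_oncePunctured,
    W.degree_ellToCore⟩

/-- An elliptically admissible `X` is `k`-isogenous to a semi-elliptic orbicurve (its core).
[cite: MochizukiAbsTopII2013, Def 3.1 p.65] -/
theorem IsEllipticallyAdmissibleWith.exists_semiElliptic {M : IsogenyModel.{u}} {X : M.Curve}
    {Q : ArithmeticQuotient (M.ext X)} (h : IsEllipticallyAdmissibleWith M X Q) :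
    ∃ C : M.Curve, M.IsSemiElliptic C ∧ M.IsCoreOf C X := by
  obtain ⟨W⟩ := h
  exact ⟨W.core, W.isSemiElliptic_core, W.isCoreOf⟩

/-! ### Corollary 3.3 (ii): the semi-elliptic double coverings, group-theoretically -/

/-- Cor 3.3 (ii) p. 68, the group-theoretic side (REAL): "the collection of open subgroups
`J ⊆ Π_C` of index `2` such that `J ∩ Δ_C` [where `Δ_C := Ker(Π_C ↠ G')`] is torsion-free [i.e.,
the covering determined by `J` is a scheme — cf. [AbsTopI], Lemma 4.1, (iv)]".
[cite: MochizukiAbsTopII2013, Cor 3.3 (ii) p.68] -/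
def semiEllipticDoubleCoverSubgroups (C : FundamentalExtension.{u}) : Set (Subgroup C.arith) :=
  {J | IsOpen (J : Set C.arith) ∧ J.index = 2 ∧ IsMulTorsionFree ↥(J ⊓ C.geom)}

/-- **Corollary 3.3 (ii)** p. 68 as a model-relative comparison (shape (M)), SPECIAL CASE
`Π = π₁` (scheme-theoretic envelope an isomorphism, `Σ` = all primes): for a semi-elliptic `C`,
"the collection of open subgroups `Π_D ⊆ Π_C` that arise from finite étale double coverings `D → C`
that exhibit `C` as semi-elliptic [cf. Remark 3.1.1] may be characterized group-theoretically as"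
`semiEllipticDoubleCoverSubgroups (π₁(C) ↠ G)`.  -- TODO(general form): arbitrary GSAFG-type
quotients `π₁ ↠ Π` with `([X],[k],Σ) ∈ 𝒟` ([AbsTopI] Def 2.1/4.6: abc-iut-L4-t4 / -t13 names).
[cite: MochizukiAbsTopII2013, Cor 3.3 (ii) p.68] -/
def Cor_3_3_ii (M : IsogenyModel.{u}) : Prop :=
  ∀ C : M.Curve, M.IsSemiElliptic C →
    {J | ∃ (D : M.Curve) (f : M.FinEt D C), M.IsOver f ∧ M.IsOncePuncturedElliptic D ∧
        M.degree f = 2 ∧ J = M.arithImage f} = semiEllipticDoubleCoverSubgroups (M.ext C)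

end Literature.AnabelianGeometry.AbsoluteAnabelian.AbsTopII
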